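import Mathlib.Analysis.SpecialFunctions.Pow.Real
import Literature.Computability.QuantumComplexity.AaronsonAmbainis

/-!
# Crux `VarianceAmplification` (stmt-QuantumAdvantage-17874, route RandomOracleGauge), line `average-and-clip` — stub `stub_params`

The parameter selection of the elementary variance amplifier (average `m` i.i.d. copies, clip at five standard
deviations; line card `Cruxes/AAConj/Lines/average-and-clip.md`), pure real arithmetic:

with `m = ⌈100/ε⌉`, `t² = 25·V/m` (five standard deviations of the averaged polynomial, `Var σ = V/m`) and
`k = ⌊1/(2t)⌋`, one has `m ≤ 200/ε`, `1 ≤ k ≤ 2/ε`, `t ≤ 1/(2k)`, `V/m ≤ t²`, and for every admissible fourth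
moment `E4 ≤ V/m³ + 3V²/m² (≤ 3.01·(V/m)²` because `V·m ≥ 100`)`: `E4 ≤ t²·(V/m)` and

  `(k/32)²·((V/m − E4/t²)(1 − (V/m)/t²) − (E4/t³)²) ≥ (1/(409600 u))·(0.8796·0.96 − 0.00058)·u ≥ 2·10⁻⁶ ≥ 10⁻⁶`

(`u = V/m`; `k ≥ (1/2t)/2` since `1/(2t) ≥ 1`). **`stub_params`** — the registered stub, BY NAME.
No definitions, no named facts.
-/

-- D-0017: single-conjunct summit ⇒ the duplicate `QuantumAdvantage.QuantumAdvantage` is mandated.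
set_option linter.dupNamespace false

noncomputable section

namespace Summit.QuantumAdvantage.QuantumAdvantage.Cruxes.VarianceAmplification.AverageAndClip

/-- **Stub `stub_params` of line `average-and-clip`** (registered signature, BY NAME): the parameter choice
`m = ⌈100/ε⌉`, `t = √(25V/m)`, `k = ⌊1/(2t)⌋` satisfies every constraint of the composition
`VarianceAmplification_of`, with the absolute variance floor `10⁻⁶`. [folklore] -/
theorem stub_params :
    ∀ (ε V : ℝ), 0 < ε → ε ≤ V → V ≤ 1 → ∃ (m k : ℕ) (t : ℝ), 1 ≤ m ∧ (m : ℝ) ≤ 200 / ε ∧ 1 ≤ k ∧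
      (k : ℝ) ≤ 2 / ε ∧ 0 < t ∧ t ≤ 1 / (2 * k) ∧ V / m ≤ t ^ 2 ∧
      ∀ E4 : ℝ, 0 ≤ E4 → E4 ≤ V / (m : ℝ) ^ 3 + 3 * V ^ 2 / (m : ℝ) ^ 2 →
        E4 ≤ t ^ 2 * (V / m) ∧
        (1 / 1000000 : ℝ) ≤ ((k : ℝ) / 32) ^ 2 * ((V / m - E4 / t ^ 2) * (1 - (V / m) / t ^ 2) - (E4 / t ^ 3) ^ 2) := by
  intro ε V hε hεV hV1
  have hV : 0 < V := lt_of_lt_of_le hε hεV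
  have hε1 : ε ≤ 1 := hεV.trans hV1
  -- the number of copies
  set m : ℕ := ⌈100 / ε⌉₊ with hm
  have hm_ge : 100 / ε ≤ (m : ℝ) := Nat.le_ceil _
  have hm_le : (m : ℝ) ≤ 100 / ε + 1 := (Nat.ceil_lt_add_one (by positivity)).le
  have h100 : (100 : ℝ) ≤ 100 / ε := by
    rw [le_div_iff₀ hε]; nlinarith
  have hm100 : (100 : ℝ) ≤ m := h100.trans hm_ge
  have hmpos : (0 : ℝ) < m := by linarith
  have hm1 : 1 ≤ m := by exact_mod_cast (show (1 : ℝ) ≤ m by linarith)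
  have hVm : 100 ≤ V * m := by
    have h1 : V * (100 / ε) ≤ V * m := mul_le_mul_of_nonneg_left hm_ge hV.le
    have h2 : 100 ≤ V * (100 / ε) := by
      rw [mul_div_assoc', le_div_iff₀ hε]; nlinarith
    linarith
  -- the variance of the average and the clipping scale
  set u : ℝ := V / m with hu
  have hu0 : 0 < u := div_pos hV hmpos
  set t : ℝ := Real.sqrt (25 * u) with ht
  have ht0 : 0 < t := Real.sqrt_pos.mpr (by positivity)
  have ht2 : t ^ 2 = 25 * u := Real.sq_sqrt (by positivity)
  -- `t ≤ 1/2` (i.e. `100 V ≤ m`)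
  have hu400 : 100 * u ≤ 1 := by
    rw [hu, mul_div_assoc', div_le_one hmpos]; nlinarith
  have ht_half : t ≤ 1 / 2 := by
    have h : t ^ 2 ≤ (1 / 2) ^ 2 := by rw [ht2]; nlinarith
    exact (pow_le_pow_iff_left₀ ht0.le (by norm_num) two_ne_zero).mp h
  -- the gain
  set y : ℝ := 1 / (2 * t) with hy
  have hy1 : 1 ≤ y := by
    rw [hy, le_div_iff₀ (by positivity)]; linarith
  have hy0 : 0 < y := by linarith
  set k : ℕ := ⌊y⌋₊ with hk
  have hk1 : 1 ≤ k := Nat.le_floor (by exact_mod_cast hy1)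
  have hk_le : (k : ℝ) ≤ y := Nat.floor_le hy0.le
  have hk_ge : y / 2 ≤ k := by
    have h1 : y < (k : ℝ) + 1 := Nat.lt_floor_add_one y
    have h2 : (1 : ℝ) ≤ k := by exact_mod_cast hk1
    linarith
  have hkpos : (0 : ℝ) < k := by exact_mod_cast hk1
  -- `u ≥ ε²/200`
  have h200 : (200 : ℝ) / ε = 100 / ε + 100 / ε := by ring
  have hm200 : (m : ℝ) ≤ 200 / ε := by
    have : (1 : ℝ) ≤ 100 / ε := le_trans (by norm_num) h100
    rw [h200]; linarith
  have hu_ge : ε ^ 2 / 200 ≤ u := by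
    rw [hu, div_le_div_iff₀ (by norm_num) hmpos]
    calc ε ^ 2 * m ≤ ε ^ 2 * (200 / ε) := mul_le_mul_of_nonneg_left hm200 (by positivity)
      _ = 200 * ε := by field_simp
      _ ≤ V * 200 := by linarith
  refine ⟨m, k, t, hm1, hm200, hk1, ?_, ht0, ?_, ?_, ?_⟩
  · -- k ≤ 2/ε :  k ≤ y = 1/(2t) ≤ 2/ε  ⟸  ε ≤ 4t  ⟸  ε² ≤ 16 t² = 400 u
    refine hk_le.trans ?_
    rw [hy, div_le_div_iff₀ (by positivity) hε]
    have h16 : ε ^ 2 ≤ (4 * t) ^ 2 := by rw [mul_pow, ht2]; nlinarith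
    have h4t : ε ≤ 4 * t := (pow_le_pow_iff_left₀ hε.le (by positivity) two_ne_zero).mp h16
    linarith
  · -- t ≤ 1/(2k)
    rw [le_div_iff₀ (by positivity)]
    have := mul_le_mul_of_nonneg_right hk_le (show (0 : ℝ) ≤ 2 * t by positivity)
    rw [hy, div_mul_cancel₀ _ (by positivity)] at this
    linarith
  · -- V/m ≤ t²
    rw [ht2]; linarith
  · intro E4 hE0 hE4
    -- E4 ≤ 3.01 u²
    have hE : E4 ≤ 301 / 100 * u ^ 2 := by
      have h1 : V / (m : ℝ) ^ 3 = u ^ 2 * (1 / (V * m)) := by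
        rw [hu]; field_simp
      have h2 : 3 * V ^ 2 / (m : ℝ) ^ 2 = 3 * u ^ 2 := by rw [hu]; field_simp
      have h3 : 1 / (V * m) ≤ 1 / 100 := div_le_div_of_nonneg_left (by norm_num) (by norm_num) hVm
      have h4 : u ^ 2 * (1 / (V * m)) ≤ u ^ 2 * (1 / 100) := mul_le_mul_of_nonneg_left h3 (sq_nonneg u)
      rw [h1, h2] at hE4
      linarith
    have ht3 : t ^ 3 = 25 * u * t := by rw [pow_succ, ht2]
    have ht6 : (t ^ 3) ^ 2 = (25 * u) ^ 3 := by
      rw [← pow_mul, show 3 * 2 = 2 * 3 from rfl, pow_mul, ht2]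
    refine ⟨?_, ?_⟩
    · -- E4 ≤ t²·u = 25 u²
      rw [ht2]; nlinarith
    · -- the variance floor
      have hA : 2199 / 2500 * u ≤ V / m - E4 / t ^ 2 := by
        rw [← hu, ht2]
        have : E4 / (25 * u) ≤ 301 / 2500 * u := by
          rw [div_le_iff₀ (by positivity)]; nlinarith
        linarith
      have hB : 1 - (V / m) / t ^ 2 = 24 / 25 := by
        rw [← hu, ht2]; field_simp; ring
      have hC : (E4 / t ^ 3) ^ 2 ≤ 90601 / 156250000 * u := by
        rw [div_pow, ht6, div_le_iff₀ (by positivity)]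
        have h1 : E4 ^ 2 ≤ (301 / 100 * u ^ 2) ^ 2 := pow_le_pow_left₀ hE0 hE 2
        nlinarith
      have hK : 1 / (409600 * u) ≤ ((k : ℝ) / 32) ^ 2 := by
        have h1 : y ^ 2 = 1 / (100 * u) := by
          rw [hy, div_pow, mul_pow, ht2]; norm_num; ring
        have h2 : (y / 2 / 32) ^ 2 ≤ ((k : ℝ) / 32) ^ 2 :=
          pow_le_pow_left₀ (by positivity) (by linarith) 2
        calc 1 / (409600 * u) = (y / 2 / 32) ^ 2 := by rw [div_pow, div_pow, h1]; field_simp; norm_num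
          _ ≤ ((k : ℝ) / 32) ^ 2 := h2
      have hX : 131849399 / 156250000 * u ≤
          (V / m - E4 / t ^ 2) * (1 - (V / m) / t ^ 2) - (E4 / t ^ 3) ^ 2 := by
        rw [hB]
        linarith [hA, hC]
      have hprod : 1 / (409600 * u) * (131849399 / 156250000 * u) = 131849399 / 64000000000000 := by
        field_simp
        ring
      calc (1 / 1000000 : ℝ) ≤ 1 / (409600 * u) * (131849399 / 156250000 * u) := by
            rw [hprod]; norm_num
        _ ≤ ((k : ℝ) / 32) ^ 2 * ((V / m - E4 / t ^ 2) * (1 - (V / m) / t ^ 2) - (E4 / t ^ 3) ^ 2) :=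
            mul_le_mul hK hX (by positivity) (by positivity)

end Summit.QuantumAdvantage.QuantumAdvantage.Cruxes.VarianceAmplification.AverageAndClip

end
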